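import Literature.NumberTheory.BeurlingPrimes.ZetaMellin
import Mathlib.Analysis.MellinTransform
import Mathlib.Analysis.SpecialFunctions.ImproperIntegrals
import Mathlib.MeasureTheory.Integral.Bochner.FundThmCalculus
import HarnessLib

/-!
# Hilberdink's uncertainty principle, II: `ζ_P(s) = s∫₁^∞ N_P(x)x^{−s−1}dx` and the continuation `Z̃`

Topic `Literature/NumberTheory/BeurlingPrimes`, grouping namespace `Hilberdink`. Everything in this
file is PROVED. Hilberdink–Lapidus 2006, §2.1: "The counting functions `N(x)` and `ψ(x)` are related
to `ζ(s)` and `φ(s)` via `ζ(s) = s∫₁^∞ N(x)x^{−s−1} dx` and `φ(s) = s∫₁^∞ ψ(x)x^{−s−1} dx`", and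
Hilberdink 2007, p. 337: "writing `N_P(x) = ρx + E(x)` with `E(x) = O(x^β)`, we have for `Re s > 1`,
`ζ_P(s) = ρs/(s−1) + s∫₁^∞ E(x)x^{−s−1} dx`. The integral on the right converges for `Re s > β`
and is an analytic function for such `s`."

* `Hilberdink.mul_setIntegral_counting_eq_tsum` — for a countable family `v_i ≥ 1` with weights
  `w_i`, `∑ ‖w_i‖ v_i^{−σ} < ∞` (`σ = Re s > 0`), and `A(x) = ∑_i w_i 1[v_i ≤ x]`:
  `s ∫₁^∞ A(x) x^{−s−1} dx = ∑_i w_i v_i^{−s}` (Fubini for `tsum`; the weighted form needed for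
  `ψ_P` in file III — the case of `N_P` is the tree's `BeurlingPrimes.zeta_eq_mul_integral_intCount`,
  `ZetaMellin.lean`);
* `Hilberdink.errN P a = 1_{(1,∞)}(N_P − a·x)`; under `|N_P(x) − ax| ≤ Cx^θ` its Mellin transform
  `mellin (errN P a) (−s) = ∫₁^∞ E(x)x^{−s−1}dx` converges and is holomorphic on `Re s > θ` with
  `‖·‖ ≤ C/(Re s − θ)` (Mathlib `mellin_differentiableAt_of_isBigO_rpow`), and
  `s · mellin (errN P a) (−s) = ζ_P(s) − as/(s−1)` for `Re s > 1` (`mul_mellin_errN_eq`);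
* `Hilberdink.Ztilde P a s = as + s(s−1)·mellin (errN P a) (−s)`: holomorphic on `Re s > θ`,
  `= (s−1)ζ_P(s)` on `Re s > 1`, `Ztilde 1 = a`, and
  `‖Ztilde s‖ ≤ a‖s‖ + ‖s‖‖s−1‖C/(Re s − θ)`. (The tree's `exists_continuation_of_intErrorLE`,
  `ZetaMellin.lean`, gives the existence of such a continuation; here we need the explicit Mellin
  form with its growth bound.)

## References
* T. W. Hilberdink, M. L. Lapidus, *Beurling zeta functions, generalised primes, and fractal
  membranes*, Acta Appl. Math. 94 (2006), arXiv:math/0410270, §2.1 (the two Mellin formulas).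
* [Hilberdink2005] T. W. Hilberdink, *Well-behaved Beurling primes and integers*, J. Number Theory
  112 (2005) 332–344, §1 (1.1) and its equivalent form.
* T. W. Hilberdink, *A lower bound for the Lindelöf function associated to generalized integers*,
  J. Number Theory 122 (2007) 336–341, p. 337 (the continuation via `E`).
-/

noncomputable section

open Set Filter MeasureTheory Complex Asymptotics
open scoped Topology

namespace Literature.NumberTheory.BeurlingPrimes

open Literature.Barriers.RiemannHypothesis

namespace Hilberdink

/-! ### Mellin transforms of counting functions -/

/-- `∫₁^∞ 1[v ≤ x] c x^r dx = −c v^{r+1}/(r+1)` for `v ≥ 1`, `Re r < −1`. [folklore] -/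
theorem setIntegral_indicator_mul_cpow {v : ℝ} (hv : 1 ≤ v) {r : ℂ} (hr : r.re < -1) (c : ℂ) :
    ∫ x in Ioi (1 : ℝ), (if v ≤ x then c else 0) * (x : ℂ) ^ r = -(c * (v : ℂ) ^ (r + 1) / (r + 1)) := by
  have h : (fun x : ℝ ↦ (if v ≤ x then c else 0) * (x : ℂ) ^ r) =
      (Ici v).indicator fun x : ℝ ↦ c * (x : ℂ) ^ r := by
    funext x
    by_cases hx : v ≤ x
    · rw [if_pos hx, indicator_of_mem (mem_Ici.mpr hx)]
    · rw [if_neg hx, indicator_of_notMem (by simpa using hx), zero_mul]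
  rw [h, setIntegral_indicator measurableSet_Ici, setIntegral_congr_set (Ioi_one_inter_Ici_ae_eq hv),
    integral_const_mul, integral_Ioi_cpow_of_lt hr (by linarith)]
  ring

/-- The norm version: `∫₁^∞ ‖1[v ≤ x] c x^r‖ dx = −‖c‖ v^{Re r+1}/(Re r+1)`. [folklore] -/
theorem setIntegral_norm_indicator_mul_cpow {v : ℝ} (hv : 1 ≤ v) {r : ℂ} (hr : r.re < -1) (c : ℂ) :
    ∫ x in Ioi (1 : ℝ), ‖(if v ≤ x then c else 0) * (x : ℂ) ^ r‖ = -(‖c‖ * v ^ (r.re + 1) / (r.re + 1)) := by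
  have h : ∀ x ∈ Ioi (1 : ℝ), ‖(if v ≤ x then c else 0) * (x : ℂ) ^ r‖ =
      (if v ≤ x then ‖c‖ else 0) * x ^ r.re := by
    intro x hx
    rw [norm_mul, norm_cpow_eq_rpow_re_of_pos (by simpa using (zero_lt_one.trans hx))]
    split_ifs <;> simp
  rw [setIntegral_congr_fun measurableSet_Ioi h]
  have h2 : (fun x : ℝ ↦ (if v ≤ x then ‖c‖ else 0) * x ^ r.re) =
      (Ici v).indicator fun x : ℝ ↦ ‖c‖ * x ^ r.re := by
    funext x
    by_cases hx : v ≤ x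
    · rw [if_pos hx, indicator_of_mem (mem_Ici.mpr hx)]
    · rw [if_neg hx, indicator_of_notMem (by simpa using hx), zero_mul]
  rw [h2, setIntegral_indicator measurableSet_Ici, setIntegral_congr_set (Ioi_one_inter_Ici_ae_eq hv),
    integral_const_mul, integral_Ioi_rpow_of_lt hr (by linarith)]
  ring

/-- Integrability of `1[v ≤ x] c x^r` on `(1, ∞)` for `Re r < −1`. [folklore] -/
theorem integrableOn_indicator_mul_cpow (v : ℝ) {r : ℂ} (hr : r.re < -1) (c : ℂ) :
    IntegrableOn (fun x : ℝ ↦ (if v ≤ x then c else 0) * (x : ℂ) ^ r) (Ioi 1) := by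
  have h : (fun x : ℝ ↦ (if v ≤ x then c else 0) * (x : ℂ) ^ r) =
      (Ici v).indicator fun x : ℝ ↦ c * (x : ℂ) ^ r := by
    funext x
    by_cases hx : v ≤ x
    · rw [if_pos hx, indicator_of_mem (mem_Ici.mpr hx)]
    · rw [if_neg hx, indicator_of_notMem (by simpa using hx), zero_mul]
  rw [h, integrableOn_indicator_iff measurableSet_Ici]
  refine IntegrableOn.mono_set ?_ inter_subset_right
  exact ((integrableOn_Ioi_cpow_of_lt hr zero_lt_one).const_mul c)

/-- **Fubini for counting functions.** For a countable family `v_i ≥ 1`, weights `w_i`, with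
`∑ ‖w_i‖ v_i^{−Re s} < ∞` and `Re s > 0`, and `A(x) = ∑_i w_i 1[v_i ≤ x]` (as a `HasSum`):
`s ∫₁^∞ A(x) x^{−s−1} dx = ∑_i w_i v_i^{−s}`. [folklore] -/
theorem mul_setIntegral_counting_eq_tsum {ι : Type*} [Countable ι] {v : ι → ℝ} {w : ι → ℂ}
    (hv : ∀ i, 1 ≤ v i) {s : ℂ} (hs : 0 < s.re) (hsum : Summable fun i ↦ ‖w i‖ * v i ^ (-s.re))
    {A : ℝ → ℂ} (hA : ∀ x, HasSum (fun i ↦ if v i ≤ x then w i else 0) (A x)) :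
    s * ∫ x in Ioi (1 : ℝ), A x * (x : ℂ) ^ (-s - 1) = ∑' i, w i * (v i : ℂ) ^ (-s) := by
  have hr : (-s - 1).re < -1 := by simp; linarith
  set F : ι → ℝ → ℂ := fun i x ↦ (if v i ≤ x then w i else 0) * (x : ℂ) ^ (-s - 1) with hF
  have hint : ∀ i, Integrable (F i) (volume.restrict (Ioi 1)) := fun i ↦
    integrableOn_indicator_mul_cpow (v i) hr (w i)
  have hnorm : ∀ i, ∫ x in Ioi (1 : ℝ), ‖F i x‖ = ‖w i‖ * v i ^ (-s.re) / s.re := by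
    intro i
    rw [hF, setIntegral_norm_indicator_mul_cpow (hv i) hr (w i)]
    simp only [sub_re, neg_re, one_re]
    have : -s.re - 1 + 1 = -s.re := by ring
    rw [this]
    field_simp
  have hFsum : Summable fun i ↦ ∫ x in Ioi (1 : ℝ), ‖F i x‖ := by
    simp_rw [hnorm]
    exact hsum.div_const _
  have hswap := integral_tsum_of_summable_integral_norm hint hFsum
  -- pointwise: `∑_i F i x = A x · x^{−s−1}`
  have hpt : ∀ x, ∑' i, F i x = A x * (x : ℂ) ^ (-s - 1) := by
    intro x
    rw [hF]
    simp only
    rw [tsum_mul_right, (hA x).tsum_eq]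
  simp_rw [hpt] at hswap
  rw [← hswap, ← tsum_mul_left]
  refine tsum_congr fun i ↦ ?_
  rw [hF, setIntegral_indicator_mul_cpow (hv i) hr (w i)]
  have h1 : -s - 1 + 1 = -s := by ring
  rw [h1]
  have hs0 : s ≠ 0 := by rintro rfl; simp at hs
  field_simp

/-! ### The error term `E = N_P − a·x` and its Mellin transform -/

variable (P : BeurlingPrimes)

/-- `E(x) = 1_{(1,∞)}(x) (N_P(x) − a x)`, complex-valued. [cite: Hilberdink2005, §2.1 (2.2)] -/
def errN (a : ℝ) : ℝ → ℂ := (Ioi 1).indicator fun x ↦ (((P.intCount x : ℝ) - a * x : ℝ) : ℂ)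

variable {P}

/-- `E(x) = N_P(x) − ax` for `x > 1`. [folklore] -/
theorem errN_of_one_lt {a x : ℝ} (hx : 1 < x) : errN P a x = (((P.intCount x : ℝ) - a * x : ℝ) : ℂ) :=
  indicator_of_mem (mem_Ioi.mpr hx) _

/-- `E(x) = 0` for `x ≤ 1`. [folklore] -/
theorem errN_of_le_one {a x : ℝ} (hx : x ≤ 1) : errN P a x = 0 :=
  indicator_of_notMem (by simpa using hx) _

/-- `E` is measurable. [folklore] -/
theorem measurable_errN (a : ℝ) : Measurable (errN P a) := by
  refine (Continuous.measurable continuous_ofReal).comp ?_ |>.indicator measurableSet_Ioi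
  exact (measurable_intCount_real P).sub (measurable_const.mul measurable_id)

variable (P) in
/-- `x ↦ (N_P(x) : ℂ)` is measurable. [folklore] -/
theorem measurable_intCount_complex : Measurable fun x : ℝ ↦ (P.intCount x : ℂ) := by
  have : (fun x : ℝ ↦ (P.intCount x : ℂ)) = (fun r : ℝ ↦ (r : ℂ)) ∘ fun x ↦ (P.intCount x : ℝ) := by
    funext x; simp
  rw [this]
  exact Complex.measurable_ofReal.comp (measurable_intCount_real P)

/-- `E` is integrable on `(0, X]` (it vanishes on `(0,1]` and is bounded measurable on `(1, X]`).
[folklore] -/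
theorem integrableOn_errN (a X : ℝ) : IntegrableOn (errN P a) (Ioc 0 X) := by
  unfold errN
  rw [integrableOn_indicator_iff measurableSet_Ioi]
  refine IntegrableOn.mono_set ?_ (show Ioi 1 ∩ Ioc 0 X ⊆ Ioc 1 X from fun x hx ↦ ⟨hx.1, hx.2.2⟩)
  refine Integrable.mono' (g := fun _ ↦ (P.intCount X : ℝ) + |a| * |X|) (integrableOn_const (by simp)) ?_ ?_
  · exact (continuous_ofReal.measurable.comp
      ((measurable_intCount_real P).sub (measurable_const.mul measurable_id))).aestronglyMeasurable
  · rw [ae_restrict_iff' measurableSet_Ioc]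
    refine Eventually.of_forall fun x hx ↦ ?_
    rw [Complex.norm_real, Real.norm_eq_abs]
    have h1 : (0 : ℝ) ≤ P.intCount x := Nat.cast_nonneg _
    have h2 : (P.intCount x : ℝ) ≤ P.intCount X := Nat.cast_le.mpr (P.intCount_mono hx.2)
    have h3 : |a * x| ≤ |a| * |X| := by
      rw [abs_mul]
      exact mul_le_mul_of_nonneg_left (abs_le_abs hx.2 (by linarith [hx.1, hx.2])) (abs_nonneg a)
    calc |(P.intCount x : ℝ) - a * x| ≤ |(P.intCount x : ℝ)| + |a * x| := abs_sub _ _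
      _ ≤ P.intCount X + |a| * |X| := by rw [abs_of_nonneg h1]; linarith

/-- `E` is locally integrable on `(0, ∞)`. [folklore] -/
theorem locallyIntegrableOn_errN (a : ℝ) : LocallyIntegrableOn (errN P a) (Ioi 0) := by
  rw [locallyIntegrableOn_iff isOpen_Ioi.isLocallyClosed]
  intro k hk hkc
  obtain ⟨X, hX⟩ := hkc.isBounded.bddAbove
  exact (integrableOn_errN a X).mono_set fun v hv ↦ ⟨hk hv, hX hv⟩

/-- `E = 0` near `0⁺`, so `E = O(x^{−b})` there for every `b`. [folklore] -/
theorem errN_isBigO_zero (a b : ℝ) : errN P a =O[𝓝[>] 0] fun x : ℝ ↦ x ^ (-b) := by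
  have h : errN P a =ᶠ[𝓝[>] 0] fun _ ↦ (0 : ℂ) := by
    have : Ioo (0 : ℝ) 1 ∈ 𝓝[>] (0 : ℝ) := Ioo_mem_nhdsGT one_pos
    filter_upwards [this] with x hx
    rw [errN_of_le_one hx.2.le]
  exact (isBigO_zero _ _).congr' h.symm EventuallyEq.rfl

/-- The Mellin transform of a function supported on `(1, ∞)`:
`mellin (1_{(1,∞)} g) s = ∫₁^∞ g(x) x^{s−1} dx`. [folklore] -/
theorem mellin_indicator_Ioi_one (g : ℝ → ℂ) (s : ℂ) :
    mellin ((Ioi 1).indicator g) s = ∫ x in Ioi (1 : ℝ), g x * (x : ℂ) ^ (s - 1) := by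
  rw [mellin]
  have h : (fun x : ℝ ↦ (x : ℂ) ^ (s - 1) • (Ioi 1).indicator g x) =
      (Ioi 1).indicator fun x ↦ g x * (x : ℂ) ^ (s - 1) := by
    funext x
    simp only [smul_eq_mul]
    by_cases hx : x ∈ Ioi (1 : ℝ)
    · rw [indicator_of_mem hx, indicator_of_mem hx, mul_comm]
    · rw [indicator_of_notMem hx, indicator_of_notMem hx, mul_zero]
  rw [h, setIntegral_indicator measurableSet_Ioi, Measure.restrict_congr_set
    (show (Ioi (0 : ℝ) ∩ Ioi 1 : Set ℝ) =ᵐ[volume] Ioi 1 by rw [Ioi_inter_Ioi, max_eq_right zero_le_one])]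

/-- `mellin (errN P a) (−s) = ∫₁^∞ (N_P(x) − ax) x^{−s−1} dx`. [folklore] -/
theorem mellin_errN_eq_setIntegral (a : ℝ) (s : ℂ) :
    mellin (errN P a) (-s) = ∫ x in Ioi (1 : ℝ), (((P.intCount x : ℝ) - a * x : ℝ) : ℂ) * (x : ℂ) ^ (-s - 1) := by
  rw [errN, mellin_indicator_Ioi_one]

section bounds

variable {a C θ : ℝ} (hN : ∀ x : ℝ, 1 ≤ x → |(P.intCount x : ℝ) - a * x| ≤ C * x ^ θ)
include hN

/-- `0 ≤ C`. [folklore] -/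
theorem const_nonneg : 0 ≤ C := by
  have := (abs_nonneg _).trans (hN 1 le_rfl)
  simpa using this

/-- `‖E(x)‖ ≤ C x^θ` for `x > 0`. [folklore] -/
theorem norm_errN_le {x : ℝ} (hx : 0 < x) : ‖errN P a x‖ ≤ C * x ^ θ := by
  rcases le_or_gt x 1 with h | h
  · rw [errN_of_le_one h, norm_zero]
    exact mul_nonneg (const_nonneg hN) (Real.rpow_nonneg hx.le _)
  · rw [errN_of_one_lt h, Complex.norm_real, Real.norm_eq_abs]
    exact hN x h.le

/-- `E = O(x^θ)` at `∞`. [folklore] -/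
theorem errN_isBigO_top : errN P a =O[atTop] fun x : ℝ ↦ x ^ (-(-θ)) := by
  refine IsBigO.of_bound C ?_
  filter_upwards [eventually_gt_atTop (0 : ℝ)] with x hx
  rw [neg_neg, Real.norm_eq_abs, abs_of_nonneg (Real.rpow_nonneg hx.le _)]
  exact norm_errN_le hN hx

/-- The Mellin transform `∫₁^∞ E(x) x^{−s−1} dx` converges (absolutely) for `Re s > θ`.
[cite: Hilberdink2005, §1] -/
theorem mellinConvergent_errN {s : ℂ} (hs : θ < s.re) : MellinConvergent (errN P a) (-s) :=
  mellinConvergent_of_isBigO_rpow (locallyIntegrableOn_errN a) (errN_isBigO_top hN)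
    (by rw [neg_re]; linarith) (errN_isBigO_zero a ((-s).re - 1)) (by linarith)

/-- **`s ↦ ∫₁^∞ E(x) x^{−s−1} dx` is holomorphic on `Re s > θ`** (Mathlib's
`mellin_differentiableAt_of_isBigO_rpow`). [cite: Hilberdink2005, §1] -/
theorem differentiableAt_mellin_errN {s : ℂ} (hs : θ < s.re) :
    DifferentiableAt ℂ (fun s ↦ mellin (errN P a) (-s)) s := by
  have h : DifferentiableAt ℂ (mellin (errN P a)) (-s) :=
    mellin_differentiableAt_of_isBigO_rpow (locallyIntegrableOn_errN a) (errN_isBigO_top hN)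
      (by rw [neg_re]; linarith) (errN_isBigO_zero a ((-s).re - 1)) (by linarith)
  exact h.comp s differentiableAt_id.neg

/-- `s ↦ ∫₁^∞ E(x) x^{−s−1} dx` is holomorphic on the half-plane `Re s > θ`. [cite: Hilberdink2005, §1] -/
theorem differentiableOn_mellin_errN :
    DifferentiableOn ℂ (fun s ↦ mellin (errN P a) (-s)) {s : ℂ | θ < s.re} :=
  fun _ hs ↦ (differentiableAt_mellin_errN hN hs).differentiableWithinAt

/-- **`‖∫₁^∞ E(x) x^{−s−1} dx‖ ≤ C/(Re s − θ)`** for `Re s > θ`. [cite: Hilberdink2005, §1] -/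
theorem norm_mellin_errN_le {s : ℂ} (hs : θ < s.re) : ‖mellin (errN P a) (-s)‖ ≤ C / (s.re - θ) := by
  rw [mellin_errN_eq_setIntegral]
  have hexp : θ - s.re - 1 < -1 := by linarith
  have hint : IntegrableOn (fun x : ℝ ↦ C * x ^ (θ - s.re - 1)) (Ioi 1) :=
    (integrableOn_Ioi_rpow_of_lt hexp zero_lt_one).const_mul C
  have hbound : ∀ᵐ x ∂(volume.restrict (Ioi (1 : ℝ))),
      ‖(((P.intCount x : ℝ) - a * x : ℝ) : ℂ) * (x : ℂ) ^ (-s - 1)‖ ≤ C * x ^ (θ - s.re - 1) := by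
    rw [ae_restrict_iff' measurableSet_Ioi]
    refine Eventually.of_forall fun x hx ↦ ?_
    have hx0 : 0 < x := zero_lt_one.trans hx
    rw [norm_mul, norm_cpow_eq_rpow_re_of_pos hx0, ← errN_of_one_lt hx]
    have hre : (-s - 1).re = -s.re - 1 := by simp
    rw [hre]
    calc ‖errN P a x‖ * x ^ (-s.re - 1) ≤ C * x ^ θ * x ^ (-s.re - 1) :=
          mul_le_mul_of_nonneg_right (norm_errN_le hN hx0) (Real.rpow_nonneg hx0.le _)
      _ = C * x ^ (θ - s.re - 1) := by rw [mul_assoc, ← Real.rpow_add hx0]; ring_nf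
  refine (norm_integral_le_of_norm_le hint hbound).trans (le_of_eq ?_)
  rw [integral_const_mul, integral_Ioi_rpow_of_lt hexp zero_lt_one, Real.one_rpow]
  have : θ - s.re - 1 + 1 = -(s.re - θ) := by ring
  rw [this, neg_div_neg_eq, ← div_eq_mul_one_div]

end bounds

/-! ### The identity `s·∫₁^∞ E x^{−s−1} = ζ_P(s) − as/(s−1)` on `Re s > 1` -/

/-- `x ↦ N_P(x) x^{−s−1}` is integrable on `(1, ∞)` for `Re s > 1` (when `N_P(x) ≤ Bx`). [folklore] -/
theorem integrableOn_intCount_mul_cpow {B : ℝ} (hB : ∀ x : ℝ, 1 ≤ x → (P.intCount x : ℝ) ≤ B * x)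
    {s : ℂ} (hs : 1 < s.re) :
    IntegrableOn (fun x : ℝ ↦ (P.intCount x : ℂ) * (x : ℂ) ^ (-s - 1)) (Ioi 1) := by
  have hmeas : AEStronglyMeasurable (fun x : ℝ ↦ (P.intCount x : ℂ) * (x : ℂ) ^ (-s - 1))
      (volume.restrict (Ioi 1)) :=
    ((measurable_intCount_complex P).mul (Complex.measurable_ofReal.pow_const _)).aestronglyMeasurable
  refine Integrable.mono' ((integrableOn_Ioi_rpow_of_lt (show -s.re < -1 by linarith) zero_lt_one).const_mul B)
    hmeas ?_
  rw [ae_restrict_iff' measurableSet_Ioi]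
  refine Eventually.of_forall fun x hx ↦ ?_
  have hx0 : 0 < x := zero_lt_one.trans hx
  rw [norm_mul, norm_cpow_eq_rpow_re_of_pos hx0, show (-s - 1).re = -s.re - 1 by simp,
    show ((P.intCount x : ℂ)) = (((P.intCount x : ℝ)) : ℂ) by simp, Complex.norm_real, Real.norm_eq_abs,
    abs_of_nonneg (Nat.cast_nonneg _)]
  calc (P.intCount x : ℝ) * x ^ (-s.re - 1) ≤ B * x * x ^ (-s.re - 1) :=
        mul_le_mul_of_nonneg_right (hB x hx.le) (Real.rpow_nonneg hx0.le _)
    _ = B * (x ^ (1 : ℝ) * x ^ (-s.re - 1)) := by rw [Real.rpow_one]; ring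
    _ = B * x ^ (-s.re) := by rw [← Real.rpow_add hx0]; ring_nf

/-- `∫₁^∞ x · x^{−s−1} dx = 1/(s − 1)` for `Re s > 1`. [folklore] -/
theorem setIntegral_mul_cpow_eq {s : ℂ} (hs : 1 < s.re) :
    ∫ x in Ioi (1 : ℝ), (x : ℂ) * (x : ℂ) ^ (-s - 1) = 1 / (s - 1) := by
  have h : ∀ x ∈ Ioi (1 : ℝ), (x : ℂ) * (x : ℂ) ^ (-s - 1) = (x : ℂ) ^ (-s) := by
    intro x hx
    have hx0 : (x : ℂ) ≠ 0 := ofReal_ne_zero.mpr (zero_lt_one.trans hx).ne'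
    calc (x : ℂ) * (x : ℂ) ^ (-s - 1) = (x : ℂ) ^ (1 : ℂ) * (x : ℂ) ^ (-s - 1) := by rw [cpow_one]
      _ = (x : ℂ) ^ ((1 : ℂ) + (-s - 1)) := (cpow_add _ _ hx0).symm
      _ = (x : ℂ) ^ (-s) := by ring_nf
  rw [setIntegral_congr_fun measurableSet_Ioi h, integral_Ioi_cpow_of_lt (by simp; linarith) zero_lt_one,
    ofReal_one, one_cpow]
  have hs1 : s - 1 ≠ 0 := by
    intro h0; have := congrArg Complex.re h0; simp at this; linarith
  have hs1' : -s + 1 ≠ 0 := by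
    intro h0; apply hs1; linear_combination -h0
  field_simp
  ring

/-- **`s · ∫₁^∞ E(x) x^{−s−1} dx = ζ_P(s) − as/(s−1)` for `Re s > 1`** (from
`ζ_P(s) = s∫₁^∞ N_P x^{−s−1}` and `s∫₁^∞ ax · x^{−s−1} = as/(s−1)`).
[cite: Hilberdink2005, §1 (1.1)] -/
theorem mul_mellin_errN_eq {B : ℝ} (hB : ∀ x : ℝ, 1 ≤ x → (P.intCount x : ℝ) ≤ B * x) (a : ℝ)
    {s : ℂ} (hs : 1 < s.re) :
    s * mellin (errN P a) (-s) = P.zeta s - a * s / (s - 1) := by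
  rw [mellin_errN_eq_setIntegral, P.zeta_eq_mul_integral_intCount hB hs]
  have h1 := integrableOn_intCount_mul_cpow hB hs
  have h2 : IntegrableOn (fun x : ℝ ↦ (a : ℂ) * ((x : ℂ) * (x : ℂ) ^ (-s - 1))) (Ioi 1) := by
    refine Integrable.const_mul ?_ _
    have h : ∀ x ∈ Ioi (1 : ℝ), (x : ℂ) ^ (-s) = (x : ℂ) * (x : ℂ) ^ (-s - 1) := by
      intro x hx
      have hx0 : (x : ℂ) ≠ 0 := ofReal_ne_zero.mpr (zero_lt_one.trans hx).ne'
      symm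
      calc (x : ℂ) * (x : ℂ) ^ (-s - 1) = (x : ℂ) ^ (1 : ℂ) * (x : ℂ) ^ (-s - 1) := by rw [cpow_one]
        _ = (x : ℂ) ^ ((1 : ℂ) + (-s - 1)) := (cpow_add _ _ hx0).symm
        _ = (x : ℂ) ^ (-s) := by ring_nf
    exact (integrableOn_Ioi_cpow_of_lt (by simp; linarith) zero_lt_one).congr_fun h measurableSet_Ioi
  have hsplit : ∀ x : ℝ, (((P.intCount x : ℝ) - a * x : ℝ) : ℂ) * (x : ℂ) ^ (-s - 1) =
      (P.intCount x : ℂ) * (x : ℂ) ^ (-s - 1) - (a : ℂ) * ((x : ℂ) * (x : ℂ) ^ (-s - 1)) := by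
    intro x; push_cast; ring
  simp_rw [hsplit]
  rw [integral_sub h1 h2, integral_const_mul, setIntegral_mul_cpow_eq hs]
  have hs1 : s - 1 ≠ 0 := by
    intro h0; have := congrArg Complex.re h0; simp at this; linarith
  field_simp

/-! ### The continuation `Z̃(s) = as + s(s−1)∫₁^∞ E x^{−s−1}` of `(s−1)ζ_P(s)` -/

/-- **`Z̃(s) = as + s(s−1) ∫₁^∞ E(x) x^{−s−1} dx`**, the continuation of `(s − 1)ζ_P(s)` to
`Re s > θ` (Hilberdink 2007, p. 337: `ζ_P(s) = ρs/(s−1) + s∫₁^∞ E(x)x^{−s−1}dx`).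
[cite: Hilberdink2005, §1] -/
def Ztilde (P : BeurlingPrimes) (a : ℝ) (s : ℂ) : ℂ := a * s + s * (s - 1) * mellin (errN P a) (-s)

/-- `Z̃(1) = a`. [folklore] -/
theorem Ztilde_one (a : ℝ) : Ztilde P a 1 = a := by simp [Ztilde]

/-- `Z̃` is holomorphic on `Re s > θ`. [cite: Hilberdink2005, §1] -/
theorem differentiableOn_Ztilde {a C θ : ℝ} (hN : ∀ x : ℝ, 1 ≤ x → |(P.intCount x : ℝ) - a * x| ≤ C * x ^ θ) :
    DifferentiableOn ℂ (Ztilde P a) {s : ℂ | θ < s.re} := by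
  unfold Ztilde
  exact ((differentiableOn_const _).mul differentiableOn_id).add
    ((differentiableOn_id.mul (differentiableOn_id.sub (differentiableOn_const _))).mul
      (differentiableOn_mellin_errN hN))

/-- **`Z̃(s) = (s − 1) ζ_P(s)` for `Re s > 1`.** [cite: Hilberdink2005, §1 (1.1)] -/
theorem Ztilde_eq_of_one_lt {B : ℝ} (hB : ∀ x : ℝ, 1 ≤ x → (P.intCount x : ℝ) ≤ B * x) (a : ℝ)
    {s : ℂ} (hs : 1 < s.re) : Ztilde P a s = (s - 1) * P.zeta s := by
  unfold Ztilde
  have hs1 : s - 1 ≠ 0 := by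
    intro h0; have := congrArg Complex.re h0; simp at this; linarith
  have h := mul_mellin_errN_eq hB a hs
  calc (a : ℂ) * s + s * (s - 1) * mellin (errN P a) (-s)
      = a * s + (s - 1) * (s * mellin (errN P a) (-s)) := by ring
    _ = a * s + (s - 1) * (P.zeta s - a * s / (s - 1)) := by rw [h]
    _ = (s - 1) * P.zeta s := by field_simp; ring

/-- **Finite order**: `‖Z̃(s)‖ ≤ a‖s‖ + ‖s‖‖s−1‖ C/(Re s − θ)` for `Re s > θ` (`a ≥ 0`).
[cite: Hilberdink2005, §1] -/
theorem norm_Ztilde_le {a C θ : ℝ} (ha : 0 ≤ a) (hN : ∀ x : ℝ, 1 ≤ x → |(P.intCount x : ℝ) - a * x| ≤ C * x ^ θ)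
    {s : ℂ} (hs : θ < s.re) : ‖Ztilde P a s‖ ≤ a * ‖s‖ + ‖s‖ * ‖s - 1‖ * (C / (s.re - θ)) := by
  unfold Ztilde
  refine (norm_add_le _ _).trans (add_le_add ?_ ?_)
  · rw [norm_mul, Complex.norm_real, Real.norm_eq_abs, abs_of_nonneg ha]
  · rw [norm_mul, norm_mul]
    exact mul_le_mul_of_nonneg_left (norm_mellin_errN_le hN hs) (by positivity)

end Hilberdink

end Literature.NumberTheory.BeurlingPrimes
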